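import Literature.MathematicalPhysics.QuantumFieldTheory.LatticeGaugeStaticPotentialProofs
import Literature.MathematicalPhysics.QuantumFieldTheory.ConstructiveQFTWave0WilsonLoopRPProofs
import Literature.RepresentationTheory.CompactGroups.UnitaryTrick
import HarnessLib

/-!
# Gauge-boot targets: certified bounds on plaquette and Wilson-loop expectations (statement layer)

Cell `pub-gaugeboot` (venture `gauge-boot`, HOME `run/shared/lean/pub/pub-gaugeboot/`), task L0, file 1/4.

HONEST FRAMING (page 1 of every file of this cell): certified bounds on lattice expectations at
STATED coupling, gauge group, dimension and torus size; NOT a mass gap, NOT a continuum limit,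
NOT a string tension, NOT large `N`. The venture is explicitly NOT Yang–Mills-summit-bearing
(barriers `FixedCouplingUltralocality`, `PerturbativeInvisibility`: fixed-coupling ultralocal data
say nothing about `a → 0`).

## Content (tree vocabulary `ConstructiveQFTWave0`: `GaugeConfig d L G`, `plaquetteHolonomy`,
`wilsonAction ρ`, `wilsonMeasure ρ β`, `wilsonExpectation ρ β`, `wilsonLoop ρ x i j R T`)

* Observables for any compact `G` and matrix representation `ρ`: the normalised plaquette trace
  `plaquetteTrace ρ x i j U = (1/N) Re tr ρ(U_{x,ij})`, its torus average over all plaquettes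
  `meanPlaquette ρ` — the ORBIT-AVERAGED object the certificates bound (SCOPING Amendment 1, A2) —
  and the averaged rectangular Wilson loop `meanWilsonLoop ρ R T` (tree `wilsonLoop`, `W(1×1) = u_P`);
  `|·| ≤ 1`, measurability for the product σ-algebra (no countability on `G`), and the affine relation
  `ū_P = 1 - S/(N·#plaquettes)` to the tree's Wilson action (`meanPlaquette_eq`).
* Targets, shape (A) (SCOPING §1.2, tribunal t1 retarget R0): for `G = SU(N)` in the fundamental
  representation at the STANDARD Wilson coupling `β_std` — tree coupling `β_tree = β_std / N`, since the
  tree weight is `exp(-β_tree ∑_P (N - Re tr U_P))` and the standard weight is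
  `exp((β_std/N) ∑_P Re tr U_P)` up to a constant —
  `PlaquetteWindow N D L₀ β_std a b := ∀ L even, L₀ ≤ L → a ≤ ⟨ū_P⟩_{(ℤ/L)^D, β_std} ≤ b` and
  `WilsonLoopWindow N D L₀ β_std R T a b` for `W̄(R×T)`; the plan's four cells
  `T1 = PlaquetteWindow 2 3` (SU(2), D=3), `T2 = PlaquetteWindow 2 4`, `T3 = PlaquetteWindow 3 3`,
  `T4 = PlaquetteWindow 3 4`, and `T1W … T4W`. `L₀` is EXPLICIT: the certificate header prints it
  (twice the largest lattice extent of any loop or reflected path product used, plus two), so that no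
  loop of the truncation wraps around the torus and every reflection-positivity block used is an
  instance of the tree theorems (`wilsonExpectation_siteReflectionPositive`,
  `wilsonExpectation_gram_link_nonneg`, …, which need `L` even).

Companion files (same directory): `MonotoneEnvelope` (A17: `β ↦ ⟨ū_P⟩_β` is monotone; transport of
certified bounds in `β`; free-energy-difference brackets), `OrbitAverages` (A2: `⟨ū_P⟩ = ⟨u_P(x,i,j)⟩`
from the tree's translation / axis-permutation invariance; the site reflection re-exported), and
`LimitPoints` (certified windows pass to infinite-volume limit points along even tori).

What is NOT here: loop equations (task L1), the named-hypothesis variant (L2), any certificate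
(numerics seats; each certificate instantiates one `PlaquetteWindow`/`WilsonLoopWindow` with its
printed `(N, D, L₀, β_std, a, b)`), and any claim about uniqueness of `L → ∞` limits, `a → 0`, `σ`
or `N → ∞`.
-/

noncomputable section

open MeasureTheory Filter Topology
open Literature.MathematicalPhysics.QuantumFieldTheory
open Literature.MathematicalPhysics.QuantumLattice (fundamentalRep continuous_fundamentalRep
  LGConfig plaquetteObs plaquetteHolonomyZd torusLift toTorusObservable IsCylinder
  IsInfiniteVolumeLimitAlong torusLogPartition)
open Literature.RepresentationTheory.CompactGroups

namespace Summit.QuantumFields.GaugeBoot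

/-! ## Observables on the torus `(ℤ/L)^d` for a general compact gauge group -/

section General

variable {d L N : ℕ} {G : Type*} [Group G] [TopologicalSpace G] [IsTopologicalGroup G]
  [CompactSpace G] [MeasurableSpace G] [BorelSpace G] (ρ : G →* Matrix (Fin N) (Fin N) ℂ)

/-- The normalised plaquette trace `u_P(U) = (1/N) Re tr ρ(U_{x,ij})` of the plaquette at `x` in the
`(i, j)` plane (KZ2024 / GLYZ2025 "plaquette variable"; junk `0` for `N = 0`). [folklore] -/
def plaquetteTrace (x : Site d L) (i j : Fin d) (U : GaugeConfig d L G) : ℝ :=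
  (N : ℝ)⁻¹ * (ρ (plaquetteHolonomy U x i j)).trace.re

/-- The torus-averaged plaquette `ū_P(U) = (#plaquettes)⁻¹ ∑ₚ u_P(U)` over ALL plaquettes
`p = (x, i < j)` of `(ℤ/L)^d` — the orbit average of `u_P` under translations and the
hyperoctahedral group (SCOPING A2: the certified object). [folklore] -/
def meanPlaquette [NeZero L] (U : GaugeConfig d L G) : ℝ :=
  (Fintype.card (Plaquette d L) : ℝ)⁻¹ * ∑ p : Plaquette d L, plaquetteTrace ρ p.1 p.2.1.1 p.2.1.2 U

/-- The torus-averaged rectangular Wilson loop `W̄(R × T)(U) = (#plaquettes)⁻¹ ∑_{(x, i<j)}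
W_{R×T}(x; i, j)(U)` (tree `wilsonLoop ρ x i j R T`: `R` steps along `i`, `T` along `j`). [folklore] -/
def meanWilsonLoop [NeZero L] (R T : ℕ) (U : GaugeConfig d L G) : ℝ :=
  (Fintype.card (Plaquette d L) : ℝ)⁻¹ * ∑ p : Plaquette d L, wilsonLoop ρ p.1 p.2.1.1 p.2.1.2 R T U

omit [TopologicalSpace G] [IsTopologicalGroup G] [CompactSpace G] [MeasurableSpace G]
  [BorelSpace G] in
/-- The `1 × 1` Wilson loop is the normalised plaquette trace. [folklore] -/
theorem wilsonLoop_one_one (x : Site d L) (i j : Fin d) :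
    wilsonLoop ρ x i j 1 1 = plaquetteTrace ρ x i j := by
  funext U
  simp only [wilsonLoop, plaquetteTrace, rectangleHolonomy, lineHolonomy, plaquetteHolonomy,
    Site.shift, Nat.cast_one, mul_one]

omit [TopologicalSpace G] [IsTopologicalGroup G] [CompactSpace G] [MeasurableSpace G]
  [BorelSpace G] in
/-- `W̄(1 × 1) = ū_P`. [folklore] -/
theorem meanWilsonLoop_one_one [NeZero L] :
    meanWilsonLoop (d := d) (L := L) ρ 1 1 = meanPlaquette ρ := by
  funext U
  simp only [meanWilsonLoop, meanPlaquette, wilsonLoop_one_one]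

omit [MeasurableSpace G] [BorelSpace G] in
/-- Exchanging the two directions does not change the plaquette trace (`U_{x,ji} = U_{x,ij}⁻¹` and
`Re tr ρ(g⁻¹) = Re tr ρ(g)` for a continuous representation of a compact group). [folklore] -/
theorem plaquetteTrace_swap (hρ : Continuous ρ) (x : Site d L) (i j : Fin d) (U : GaugeConfig d L G) :
    plaquetteTrace ρ x j i U = plaquetteTrace ρ x i j U := by
  simp only [plaquetteTrace, plaquetteHolonomy_swap U x i j, CompactGroup.re_trace_map_inv ρ hρ]

omit [MeasurableSpace G] [BorelSpace G] in
/-- `|u_P| ≤ 1` (`|Re tr ρ(g)| ≤ N` for a continuous `N`-dimensional representation of a compact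
group, `CompactGroup.abs_re_trace_le_card`). [folklore] -/
theorem abs_plaquetteTrace_le_one (hρ : Continuous ρ) (x : Site d L) (i j : Fin d)
    (U : GaugeConfig d L G) : |plaquetteTrace ρ x i j U| ≤ 1 := by
  unfold plaquetteTrace
  have h := CompactGroup.abs_re_trace_le_card ρ hρ (plaquetteHolonomy U x i j)
  rw [Fintype.card_fin] at h
  rcases Nat.eq_zero_or_pos N with hN | hN
  · subst hN; simp
  · rw [abs_mul, abs_inv, Nat.abs_cast]
    calc (N : ℝ)⁻¹ * |(ρ (plaquetteHolonomy U x i j)).trace.re| ≤ (N : ℝ)⁻¹ * N := by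
          gcongr
      _ = 1 := inv_mul_cancel₀ (by exact_mod_cast hN.ne')

omit [MeasurableSpace G] [BorelSpace G] in
/-- `|ū_P| ≤ 1`. [folklore] -/
theorem abs_meanPlaquette_le_one [NeZero L] (hρ : Continuous ρ) (U : GaugeConfig d L G) :
    |meanPlaquette ρ U| ≤ 1 := by
  unfold meanPlaquette
  rcases isEmpty_or_nonempty (Plaquette d L) with hP | hP
  · simp
  · rw [abs_mul, abs_inv, Nat.abs_cast]
    have hcard : (0 : ℝ) < Fintype.card (Plaquette d L) := by exact_mod_cast Fintype.card_pos
    calc (Fintype.card (Plaquette d L) : ℝ)⁻¹ * |∑ p : Plaquette d L,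
            plaquetteTrace ρ p.1 p.2.1.1 p.2.1.2 U|
          ≤ (Fintype.card (Plaquette d L) : ℝ)⁻¹ * ∑ _p : Plaquette d L, (1 : ℝ) := by
            gcongr
            exact (Finset.abs_sum_le_sum_abs _ _).trans
              (Finset.sum_le_sum fun p _ => abs_plaquetteTrace_le_one ρ hρ _ _ _ U)
      _ = 1 := by
            rw [Finset.sum_const, Finset.card_univ, nsmul_eq_mul, mul_one]
            exact inv_mul_cancel₀ hcard.ne'

omit [CompactSpace G] in
/-- `u_P` is measurable for the product σ-algebra (no countability assumption on `G`: the matrix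
entries of the link variables under the continuous `ρ` are measurable, `WilsonRP.EntryMeasurable`).
[folklore] -/
theorem measurable_plaquetteTrace (hρ : Continuous ρ) (x : Site d L) (i j : Fin d) :
    Measurable (plaquetteTrace (d := d) (L := L) (G := G) ρ x i j) := by
  unfold plaquetteTrace plaquetteHolonomy
  exact (((((WilsonRP.entryMeasurable_apply hρ _).mul (WilsonRP.entryMeasurable_apply hρ _)).mul
    (WilsonRP.entryMeasurable_apply_inv hρ _)).mul
      (WilsonRP.entryMeasurable_apply_inv hρ _)).measurable_trace_re).const_mul _

omit [CompactSpace G] in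
/-- `ū_P` is measurable. [folklore] -/
theorem measurable_meanPlaquette [NeZero L] (hρ : Continuous ρ) :
    Measurable (meanPlaquette (d := d) (L := L) (G := G) ρ) := by
  unfold meanPlaquette
  exact (Finset.measurable_sum _ fun p _ => measurable_plaquetteTrace ρ hρ _ _ _).const_mul _

omit [TopologicalSpace G] [IsTopologicalGroup G] [CompactSpace G] [MeasurableSpace G]
  [BorelSpace G] in
/-- **`ū_P` is an affine function of the Wilson action**: `ū_P(U) = 1 - S(U)/(N · #plaquettes)`
(`S = ∑ₚ (N - Re tr ρ(U_p))`), for `N ≥ 1` and a torus with at least one plaquette. [folklore] -/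
theorem meanPlaquette_eq [NeZero L] [Nonempty (Plaquette d L)] (hN : N ≠ 0) (U : GaugeConfig d L G) :
    meanPlaquette ρ U = 1 - wilsonAction ρ U / (N * Fintype.card (Plaquette d L)) := by
  have hN' : (N : ℝ) ≠ 0 := by exact_mod_cast hN
  have hP : (Fintype.card (Plaquette d L) : ℝ) ≠ 0 := by exact_mod_cast Fintype.card_pos.ne'
  rw [WilsonRP.wilsonAction_eq ρ U]
  unfold meanPlaquette plaquetteTrace WilsonRP.plaqRe
  rw [← Finset.mul_sum]
  field_simp
  ring

end General

/-! ## The targets: `SU(N)` at the standard Wilson coupling, shape (A) -/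

section Targets

/-- `SU(N)` (Mathlib `Matrix.specialUnitaryGroup (Fin N) ℂ`; compactness, topological-group and Borel
instances from the tree file `GaugeGroups`). -/
abbrev SU (N : ℕ) : Type := ↥(Matrix.specialUnitaryGroup (Fin N) ℂ)

/-- The fundamental representation `SU(N) ↪ M_N(ℂ)` (tree `fundamentalRep`). -/
abbrev suRep (N : ℕ) : SU N →* Matrix (Fin N) (Fin N) ℂ := fundamentalRep (Fin N)

/-- The fundamental representation is continuous (tree `continuous_fundamentalRep`). [folklore] -/
theorem continuous_suRep (N : ℕ) : Continuous (suRep N) := continuous_fundamentalRep (Fin N)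

/-- **`⟨ū_P⟩_{(ℤ/L)^D, SU(N), β_std}`**: the expectation of the torus-averaged plaquette
`(1/N) Re tr U_P` in the Wilson theory with the STANDARD action
`S_std = β_std ∑_P (1 - (1/N) Re tr U_P)`, i.e. the tree's `wilsonMeasure (suRep N) (β_std / N)`
(tree weight `exp(-β_tree ∑_P (N - Re tr U_P))`, `β_tree = β_std / N`). Conversions to the print
literature: `λ = N²/β_std` ('t Hooft, AK2017/KZ2022/GLYZ2025), `λ_KZ24 = 2N²/β_std`. -/
def plaquetteExpectation (N D L : ℕ) [NeZero L] (β : ℝ) : ℝ :=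
  wilsonExpectation (suRep N) (β / N) (meanPlaquette (d := D) (L := L) (suRep N))

/-- **`⟨W̄(R×T)⟩_{(ℤ/L)^D, SU(N), β_std}`**: the expectation of the torus-averaged `R × T` Wilson loop
`(1/N) Re tr U_{R×T}` at standard coupling `β_std` (tree coupling `β_std / N`). -/
def wilsonLoopExpectation (N D L : ℕ) [NeZero L] (β : ℝ) (R T : ℕ) : ℝ :=
  wilsonExpectation (suRep N) (β / N) (meanWilsonLoop (d := D) (L := L) (suRep N) R T)

/-- **Target shape (A), plaquette** (SCOPING §1.2, tribunal t1 R0). For `SU(N)` lattice gauge theory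
in `D` dimensions at standard Wilson coupling `β_std` and printed rationals `a ≤ b`:
for EVERY even torus side `L ≥ L₀`, `a ≤ ⟨ū_P⟩_{(ℤ/L)^D, β_std} ≤ b`.
`L₀` is the certificate's explicit threshold (twice the largest lattice extent of any loop or
reflected path product it uses, plus two), so that no loop of the truncation wraps around the
torus and every reflection-positivity block it uses is an instance of the tree theorems (even `L`).
HONEST FRAMING: a statement about lattice expectations at the stated `(N, D, β_std)` for all large
even tori; nothing about `a → 0`, a mass gap, a string tension or `N → ∞`. -/
def PlaquetteWindow (N D L₀ : ℕ) (β a b : ℝ) : Prop :=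
  ∀ (L : ℕ) [NeZero L], Even L → L₀ ≤ L →
    a ≤ plaquetteExpectation N D L β ∧ plaquetteExpectation N D L β ≤ b

/-- **Target shape (A), rectangular Wilson loop `W(R×T)`** (tribunal t1 R4): for every even torus
side `L ≥ L₀`, `a ≤ ⟨W̄(R×T)⟩_{(ℤ/L)^D, SU(N), β_std} ≤ b`. Creutz-ratio brackets are DERIVED from
such windows by interval arithmetic on the endpoints; no string tension is claimed. -/
def WilsonLoopWindow (N D L₀ : ℕ) (β : ℝ) (R T : ℕ) (a b : ℝ) : Prop :=
  ∀ (L : ℕ) [NeZero L], Even L → L₀ ≤ L →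
    a ≤ wilsonLoopExpectation N D L β R T ∧ wilsonLoopExpectation N D L β R T ≤ b

/-- **T1** (SCOPING §1.2): the plaquette window for `SU(2)`, `D = 3`. -/
abbrev T1 (L₀ : ℕ) (β a b : ℝ) : Prop := PlaquetteWindow 2 3 L₀ β a b

/-- **T2**: the plaquette window for `SU(2)`, `D = 4`. -/
abbrev T2 (L₀ : ℕ) (β a b : ℝ) : Prop := PlaquetteWindow 2 4 L₀ β a b

/-- **T3**: the plaquette window for `SU(3)`, `D = 3`. -/
abbrev T3 (L₀ : ℕ) (β a b : ℝ) : Prop := PlaquetteWindow 3 3 L₀ β a b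

/-- **T4**: the plaquette window for `SU(3)`, `D = 4` (Option C row N4). -/
abbrev T4 (L₀ : ℕ) (β a b : ℝ) : Prop := PlaquetteWindow 3 4 L₀ β a b

/-- **T1W**: the `W(R×T)` window for `SU(2)`, `D = 3`. -/
abbrev T1W (L₀ : ℕ) (β : ℝ) (R T : ℕ) (a b : ℝ) : Prop := WilsonLoopWindow 2 3 L₀ β R T a b

/-- **T2W**: the `W(R×T)` window for `SU(2)`, `D = 4`. -/
abbrev T2W (L₀ : ℕ) (β : ℝ) (R T : ℕ) (a b : ℝ) : Prop := WilsonLoopWindow 2 4 L₀ β R T a b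

/-- **T3W**: the `W(R×T)` window for `SU(3)`, `D = 3`. -/
abbrev T3W (L₀ : ℕ) (β : ℝ) (R T : ℕ) (a b : ℝ) : Prop := WilsonLoopWindow 3 3 L₀ β R T a b

/-- **T4W**: the `W(R×T)` window for `SU(3)`, `D = 4`. -/
abbrev T4W (L₀ : ℕ) (β : ℝ) (R T : ℕ) (a b : ℝ) : Prop := WilsonLoopWindow 3 4 L₀ β R T a b

/-- Example of a certificate TYPE (numbers are placeholders, not claims): `SU(2)`, `D = 4`,
`β_std = 22/10`, `L₀ = 8`. -/
example : Prop := T2 8 (22 / 10) (1 / 2) (7 / 10)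

/-- Example of a `W(2×2)` certificate TYPE for `SU(2)`, `D = 4` (placeholders). -/
example : Prop := T2W 10 (22 / 10) 2 2 0 (1 / 2)

/-- `W(1×1)` windows are plaquette windows. -/
theorem wilsonLoopExpectation_one_one (N D L : ℕ) [NeZero L] (β : ℝ) :
    wilsonLoopExpectation N D L β 1 1 = plaquetteExpectation N D L β := by
  simp only [wilsonLoopExpectation, plaquetteExpectation, meanWilsonLoop_one_one]

end Targets

end Summit.QuantumFields.GaugeBoot

end
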